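import Summits.Ventures.CertifiedManyBodySolver.Downfold.EmeryZoneOrbitalContent
import Summits.Ventures.CertifiedManyBodySolver.Downfold.EmeryFermiScalePoint
import HarnessLib

/-!
# THE ORBITAL PARTITION OF THE HOLES OVER THE ZONE, II: the kernel certificate (definitions and component soundness)

Venture CertifiedManyBodySolver, cell `pub/hubbard-downfold` (stage S1; INFLATION-RULES-3to1-B §B.81), seat hubbard-downfold-mod-4
(technique B, g33); namespace `Summit.Ventures.CertifiedManyBodySolver.Downfold.Emery`. Everything PROVED (0 sorry). WHAT THIS IS NOT: a
statement about any material; `U = 0` one-body kinematics of the σ model.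

THE CERTIFICATE (`ZoneCert`, checker `zoneCheck`, all INTEGER arithmetic in the loops; exact `ℚ` only per level / per shell):
* the `K = 384` momentum grid of `EmeryFermiFillingGrid384` as integer tables `XL, XH` (numerators /10⁹) and its `K = 64` sub-grid
  (every sixth node; `gridEncl64`);
* ENERGY LEVELS `E_m = e₁ + m·h`, `m = 0 … M−1`; per level the exact `cA, fsD, fsN, 3E² + 4ΔE + Δ², t_pd², t_pp²` scaled by `10¹²`
  to integers (`levelZ`, integrality CHECKED, `levelOK`); integer OUTER sign test `outerZ` (⇒ `E < ε_AB` on a closed cell, via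
  `lt_abBand_on_cell`) and INNER Taylor test `innerZ` (⇒ `ε_AB < E`, via `abBand_lt_on_cell`); row-threshold STAIRCASES: fine
  (`jin1` at `e₁`, `jout2` at `e₂`, `fineInOK` / `fineOutOK`) and coarse (per row a code `100·co + ci` per level, `coarseRowOK`; the
  last level must be above the band everywhere);
This file (part II) carries the tables, the levels and the cell energy statements (`fine_hole_cell`, `fine_occ_cell`, `coarse_hole_cell`,
`coarse_occ_cell`); part III (`EmeryZoneOrbitalContentShell`) the energy shells, integerised Möbius weights and the per-cell weight
enclosure; part IV (`EmeryZoneOrbitalContentCert`) the certificate structure, the sums and the assembled theorem `zone_bounds_of_check`.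

Sources: three-band model [HybertsenSchluterChristensen1989, Eq. (1)]; [AndersenEtAl1995, §6]; interval arithmetic [folklore]
(R. E. Moore, Interval Analysis, 1966).
-/

namespace Summit.Ventures.CertifiedManyBodySolver.Downfold.Emery

open Real Set

/-! ## §1 Constants, tables, the coarse grid -/

/-- Table scale `10⁹`. [folklore] -/
def gN : ℤ := 1000000000

/-- Weight scale `10⁵`. [folklore] -/
def wW : ℤ := 100000

/-- Level scale `10¹²` (parameters and energies with ≤ 4 decimals make `cA, fsD, fsN, …` integral at this scale). [folklore] -/
def LQ : ℕ := 1000000000000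

/-- Lower table numerator `XL i = 10⁹·xl384 i`. [folklore] -/
def XL (i : ℕ) : ℤ := ((grid384LoN.getD i 0 : ℕ) : ℤ)

/-- Upper table numerator `XH i = 10⁹·xh384 i`. [folklore] -/
def XH (i : ℕ) : ℤ := ((grid384HiN.getD i 1000000000 : ℕ) : ℤ)

/-- `xl384 i = XL i / 10⁹` in `ℝ`. [folklore] -/
theorem xl384_cast (i : ℕ) : ((xl384 i : ℚ) : ℝ) = ((XL i : ℤ) : ℝ) / 1000000000 := by
  unfold xl384 XL; push_cast; ring

/-- `xh384 i = XH i / 10⁹` in `ℝ`. [folklore] -/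
theorem xh384_cast (i : ℕ) : ((xh384 i : ℚ) : ℝ) = ((XH i : ℤ) : ℝ) / 1000000000 := by
  unfold xh384 XH; push_cast; ring

/-- Table sanity (monotone, within `[0, 10⁹]`), checked once by the kernel. [folklore] -/
def tablesOK : Bool :=
  (List.range 384).all (fun i => decide (XL i ≤ XL (i + 1)) && decide (XH i ≤ XH (i + 1))) &&
  (List.range 385).all (fun i => decide (0 ≤ XL i) && decide (XL i ≤ gN) && decide (0 ≤ XH i) && decide (XH i ≤ gN))

/-- [folklore] -/
theorem tablesOK_true : tablesOK = true := by decide +kernel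

/-- `XL` is monotone on `0 … 384`. [folklore] -/
theorem XL_mono {i j : ℕ} (hij : i ≤ j) (hj : j ≤ 384) : XL i ≤ XL j := by
  have h := tablesOK_true
  simp only [tablesOK, Bool.and_eq_true, List.all_eq_true, List.mem_range, decide_eq_true_eq] at h
  induction j, hij using Nat.le_induction with
  | base => exact le_rfl
  | succ n hin ih => exact (ih (by omega)).trans (h.1 n (by omega)).1

/-- `XH` is monotone on `0 … 384`. [folklore] -/
theorem XH_mono {i j : ℕ} (hij : i ≤ j) (hj : j ≤ 384) : XH i ≤ XH j := by
  have h := tablesOK_true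
  simp only [tablesOK, Bool.and_eq_true, List.all_eq_true, List.mem_range, decide_eq_true_eq] at h
  induction j, hij using Nat.le_induction with
  | base => exact le_rfl
  | succ n hin ih => exact (ih (by omega)).trans (h.1 n (by omega)).2

/-- Table range facts for `i ≤ 384`. [folklore] -/
theorem tables_range {i : ℕ} (hi : i ≤ 384) : 0 ≤ XL i ∧ XL i ≤ gN ∧ 0 ≤ XH i ∧ XH i ≤ gN := by
  have h := tablesOK_true
  simp only [tablesOK, Bool.and_eq_true, List.all_eq_true, List.mem_range, decide_eq_true_eq] at h
  obtain ⟨⟨⟨h1, h2⟩, h3⟩, h4⟩ := h.2 i (by omega)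
  exact ⟨h1, h2, h3, h4⟩

/-- Coarse lower table `XL (6I)`, `I = 0 … 64`, as a short list (cheap kernel access). [folklore] -/
def xl6tab : List ℤ := (List.range 65).map fun I => XL (6 * I)

/-- Coarse upper table `XH (6I)`, `I = 0 … 64`. [folklore] -/
def xh6tab : List ℤ := (List.range 65).map fun I => XH (6 * I)

/-- `XL6 I = XL (6I)` via the short table. [folklore] -/
def XL6 (I : ℕ) : ℤ := xl6tab.getD I 0

/-- `XH6 I = XH (6I)` via the short table. [folklore] -/
def XH6 (I : ℕ) : ℤ := xh6tab.getD I 0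

/-- [folklore] -/
theorem XL6_eq {I : ℕ} (hI : I ≤ 64) : XL6 I = XL (6 * I) := by
  unfold XL6 xl6tab; rw [List.getD_eq_getElem _ _ (by simpa using (by omega : I < 65))]; simp

/-- [folklore] -/
theorem XH6_eq {I : ℕ} (hI : I ≤ 64) : XH6 I = XH (6 * I) := by
  unfold XH6 xh6tab; rw [List.getD_eq_getElem _ _ (by simpa using (by omega : I < 65))]; simp

/-- The `K = 64` sub-grid (every sixth node of the `K = 384` grid) is enclosed by the sub-tables. [folklore] -/
theorem gridEncl64 : GridEncl 64 (fun i => xl384 (6 * i)) (fun i => xh384 (6 * i)) := by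
  intro i hi
  have e : gridPt 64 i = gridPt 384 (6 * i) := by
    rw [show (384 : ℕ) = 6 * 64 from rfl, gridPt_nested (by norm_num : 0 < 6)]
  have h := gridEncl384 (6 * i) (by omega)
  rw [e]
  exact h

/-! ## §2 Levels: exact coefficients scaled to integers, and the two integer tests -/

/-- Integer level data: `10¹²·(cA, fsD, fsN, 3E² + 4ΔE + Δ², t_pd², t_pp²)`. [folklore] -/
structure LevelZ where
  /-- `10¹²·cA(E)` -/
  A : ℤ
  /-- `10¹²·fsD(E)` -/
  D : ℤ
  /-- `10¹²·fsN(E)` -/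
  N : ℤ
  /-- `10¹²·(3E² + 4ΔE + Δ²)` -/
  T : ℤ
  /-- `10¹²·t_pd²` -/
  A2 : ℤ
  /-- `10¹²·t_pp²` -/
  B2 : ℤ

/-- The six exact level rationals. [folklore] -/
def levelQ (Δ a b c e : ℚ) : List ℚ :=
  [cAQ Δ e, fsDQ Δ a c e, fsNQ a b c e, 3 * e ^ 2 + 4 * Δ * e + Δ ^ 2, a ^ 2, b ^ 2]

/-- Integerised level data (numerators after scaling by `10¹²`). [folklore] -/
def levelZ (Δ a b c e : ℚ) : LevelZ where
  A := (cAQ Δ e * LQ).num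
  D := (fsDQ Δ a c e * LQ).num
  N := (fsNQ a b c e * LQ).num
  T := ((3 * e ^ 2 + 4 * Δ * e + Δ ^ 2) * LQ).num
  A2 := (a ^ 2 * LQ).num
  B2 := (b ^ 2 * LQ).num

/-- Level admissibility: integrality at scale `10¹²`, `fsD, fsN ≥ 0`, `E ≥ 0`. [folklore] -/
def levelOK (Δ a b c e : ℚ) : Bool :=
  (levelQ Δ a b c e).all (fun q => decide ((q * LQ).den = 1)) &&
  decide (0 ≤ fsDQ Δ a c e) && decide (0 ≤ fsNQ a b c e) && decide (0 ≤ e)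

/-- OUTER integer sign test at table corners `X, Y` (numerators): `10¹²·10¹⁸·(cA − 4fsD(x + y) − 16fsN·xy) < 0`. [folklore] -/
def outerZ (lv : LevelZ) (X Y : ℤ) : Bool :=
  decide (lv.A * gN ^ 2 - 4 * lv.D * gN * (X + Y) - 16 * lv.N * (X * Y) < 0)

/-- INNER integer Taylor test at table corners `U, V`. [folklore] -/
def innerZ (lv : LevelZ) (U V : ℤ) : Bool :=
  decide (0 < lv.A * gN ^ 2 - 4 * lv.D * gN * (U + V) - 16 * lv.N * (U * V)) &&
  decide (0 ≤ lv.T * gN ^ 2 - 16 * lv.B2 * (U * V) - 4 * lv.A2 * gN * (U + V))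

/-- A rational with denominator `1` after scaling is its numerator. [folklore] -/
theorem num_cast_of_den {q : ℚ} {L : ℕ} (h : (q * L).den = 1) : (((q * L).num : ℤ) : ℝ) = (q : ℝ) * L := by
  have := Rat.coe_int_num_of_den_eq_one h
  have e : (((q * L).num : ℤ) : ℚ) = q * L := this
  exact_mod_cast congrArg (fun r : ℚ => (r : ℝ)) e

/-- What `levelOK` gives on the real side. [folklore] -/
theorem levelZ_spec {Δ a b c e : ℚ} (h : levelOK Δ a b c e = true) :
    ((levelZ Δ a b c e).A : ℝ) = cA (Δ : ℝ) e * LQ ∧ ((levelZ Δ a b c e).D : ℝ) = fsD (Δ : ℝ) a c e * LQ ∧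
    ((levelZ Δ a b c e).N : ℝ) = fsN (a : ℝ) b c e * LQ ∧
    ((levelZ Δ a b c e).T : ℝ) = (3 * (e : ℝ) ^ 2 + 4 * Δ * e + Δ ^ 2) * LQ ∧
    ((levelZ Δ a b c e).A2 : ℝ) = (a : ℝ) ^ 2 * LQ ∧ ((levelZ Δ a b c e).B2 : ℝ) = (b : ℝ) ^ 2 * LQ ∧
    0 ≤ fsD (Δ : ℝ) a c e ∧ 0 ≤ fsN (a : ℝ) b c e ∧ (0 : ℝ) ≤ e := by
  simp only [levelOK, levelQ, Bool.and_eq_true, List.all_cons, List.all_nil, decide_eq_true_eq, and_true] at h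
  obtain ⟨⟨⟨⟨h1, h2, h3, h4, h5, h6⟩, hD⟩, hN⟩, he⟩ := h
  refine ⟨?_, ?_, ?_, ?_, ?_, ?_, ?_, ?_, by exact_mod_cast he⟩
  · rw [← cast_cAQ]; exact num_cast_of_den h1
  · rw [← cast_fsDQ]; exact num_cast_of_den h2
  · rw [← cast_fsNQ]; exact num_cast_of_den h3
  · have := num_cast_of_den h4; simp only [levelZ]; rw [this]; push_cast; ring
  · have := num_cast_of_den h5; simp only [levelZ]; rw [this]; push_cast; ring
  · have := num_cast_of_den h6; simp only [levelZ]; rw [this]; push_cast; ring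
  · rw [← cast_fsDQ]; exact_mod_cast hD
  · rw [← cast_fsNQ]; exact_mod_cast hN

/-- **OUTER TEST SOUNDNESS**: the integer test at numerators `(X, Y)` gives the real sign test at `(X/10⁹, Y/10⁹)`. [folklore] -/
theorem outer_real_of_outerZ {Δ a b c e : ℚ} (hl : levelOK Δ a b c e = true) {X Y : ℤ}
    (h : outerZ (levelZ Δ a b c e) X Y = true) :
    cA (Δ : ℝ) e - 4 * fsD (Δ : ℝ) a c e * ((X : ℝ) / 1000000000 + (Y : ℝ) / 1000000000)
      - 16 * fsN (a : ℝ) b c e * ((X : ℝ) / 1000000000 * ((Y : ℝ) / 1000000000)) < 0 := by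
  obtain ⟨hA, hD, hN, -, -, -, -, -, -⟩ := levelZ_spec hl
  simp only [outerZ, decide_eq_true_eq] at h
  have h' := (Int.cast_lt (R := ℝ)).2 h
  push_cast at h'
  rw [hA, hD, hN] at h'
  simp only [gN, LQ] at h'
  push_cast at h'
  nlinarith [h']

/-- **INNER TEST SOUNDNESS**: the integer Taylor test at numerators `(U, V)` gives the two real inequalities at `(U/10⁹, V/10⁹)`. [folklore] -/
theorem inner_real_of_innerZ {Δ a b c e : ℚ} (hl : levelOK Δ a b c e = true) {U V : ℤ}
    (h : innerZ (levelZ Δ a b c e) U V = true) :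
    0 < cA (Δ : ℝ) e - 4 * fsD (Δ : ℝ) a c e * ((U : ℝ) / 1000000000 + (V : ℝ) / 1000000000)
      - 16 * fsN (a : ℝ) b c e * ((U : ℝ) / 1000000000 * ((V : ℝ) / 1000000000)) ∧
    0 ≤ 3 * (e : ℝ) ^ 2 + 4 * Δ * e + Δ ^ 2 - 16 * (b : ℝ) ^ 2 * ((U : ℝ) / 1000000000 * ((V : ℝ) / 1000000000))
      - 4 * (a : ℝ) ^ 2 * ((U : ℝ) / 1000000000 + (V : ℝ) / 1000000000) := by
  obtain ⟨hA, hD, hN, hT, hA2, hB2, -, -, -⟩ := levelZ_spec hl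
  simp only [innerZ, Bool.and_eq_true, decide_eq_true_eq] at h
  obtain ⟨h1, h2⟩ := h
  have h1' := (Int.cast_lt (R := ℝ)).2 h1
  have h2' := (Int.cast_le (R := ℝ)).2 h2
  push_cast at h1' h2'
  rw [hA, hD, hN] at h1'
  rw [hT, hA2, hB2] at h2'
  simp only [gN, LQ] at h1' h2'
  push_cast at h1' h2'
  constructor
  · nlinarith [h1']
  · nlinarith [h2']

/-! ## §3 Cells: energy statements from the integer tests (fine `K = 384`, coarse `K = 64`) -/

/-- FINE HOLE CELL: an outer test at `(XL i, XL j₀)` with `j₀ ≤ j` puts the fine closed cell `(i, j)` in `{e < ε_AB}`. [folklore] -/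
theorem fine_hole_cell {Δ a b c e : ℚ} (hl : levelOK Δ a b c e = true) {i j₀ j : ℕ} (hi : i < 384) (hj₀ : j₀ ≤ j) (hj : j < 384)
    (h : outerZ (levelZ Δ a b c e) (XL i) (XL j₀) = true) {k : ℝ × ℝ} (hk : k ∈ cellIcc 384 (i, j)) :
    (e : ℝ) < abEnergyK (Δ : ℝ) a b c k := by
  obtain ⟨-, -, -, -, -, -, hD, hN, -⟩ := levelZ_spec hl
  have ht := outer_real_of_outerZ hl h
  refine lt_abBand_on_cell (by norm_num) gridEncl384 (by omega) (by omega) hD hN ?_ hk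
  rw [xl384_cast, xl384_cast]
  have hm : ((XL j₀ : ℤ) : ℝ) ≤ ((XL j : ℤ) : ℝ) := by exact_mod_cast XL_mono hj₀ (by omega)
  have h0 : (0 : ℝ) ≤ ((XL i : ℤ) : ℝ) := by exact_mod_cast (tables_range (i := i) (by omega)).1
  have h0' : (0 : ℝ) ≤ ((XL j₀ : ℤ) : ℝ) := by exact_mod_cast (tables_range (i := j₀) (by omega)).1
  nlinarith [mul_nonneg hD (sub_nonneg.2 hm), mul_nonneg (mul_nonneg hN h0) (sub_nonneg.2 hm)]

/-- FINE OCCUPIED CELL: an inner test at `(XH (i+1), XH j₁)` with `j + 1 ≤ j₁` puts the fine cell `(i, j)` in `{ε_AB < e}`. [folklore] -/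
theorem fine_occ_cell {Δ a b c e : ℚ} (hl : levelOK Δ a b c e = true) (hΔ : 0 ≤ Δ) (hc : 0 ≤ c) {i j₁ j : ℕ} (hi : i < 384)
    (hj : j + 1 ≤ j₁) (hj₁ : j₁ ≤ 384) (h : innerZ (levelZ Δ a b c e) (XH (i + 1)) (XH j₁) = true) {k : ℝ × ℝ}
    (hk : k ∈ cellIcc 384 (i, j)) : abEnergyK (Δ : ℝ) a b c k < (e : ℝ) := by
  obtain ⟨-, -, -, -, -, -, hD, hN, he⟩ := levelZ_spec hl
  obtain ⟨h1, h2⟩ := inner_real_of_innerZ hl h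
  refine abBand_lt_on_cell (by norm_num) gridEncl384 (by omega) (by omega) (by exact_mod_cast hΔ) (by exact_mod_cast hc) he hD hN
    ?_ ?_ hk
  · rw [xh384_cast, xh384_cast]
    have hm : ((XH (j + 1) : ℤ) : ℝ) ≤ ((XH j₁ : ℤ) : ℝ) := by exact_mod_cast XH_mono hj hj₁
    have h0 : (0 : ℝ) ≤ ((XH (i + 1) : ℤ) : ℝ) := by exact_mod_cast (tables_range (i := i + 1) (by omega)).2.2.1
    nlinarith [mul_nonneg hD (sub_nonneg.2 hm), mul_nonneg (mul_nonneg hN h0) (sub_nonneg.2 hm)]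
  · rw [xh384_cast, xh384_cast]
    have hm : ((XH (j + 1) : ℤ) : ℝ) ≤ ((XH j₁ : ℤ) : ℝ) := by exact_mod_cast XH_mono hj hj₁
    have h0 : (0 : ℝ) ≤ ((XH (i + 1) : ℤ) : ℝ) := by exact_mod_cast (tables_range (i := i + 1) (by omega)).2.2.1
    have hb : (0 : ℝ) ≤ (b : ℝ) ^ 2 := sq_nonneg _
    have ha : (0 : ℝ) ≤ (a : ℝ) ^ 2 := sq_nonneg _
    nlinarith [mul_nonneg (mul_nonneg hb h0) (sub_nonneg.2 hm), mul_nonneg ha (sub_nonneg.2 hm)]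

/-- COARSE HOLE CELL (`K = 64`, every sixth node). [folklore] -/
theorem coarse_hole_cell {Δ a b c e : ℚ} (hl : levelOK Δ a b c e = true) {I J₀ J : ℕ} (hI : I < 64) (hJ₀ : J₀ ≤ J) (hJ : J < 64)
    (h : outerZ (levelZ Δ a b c e) (XL6 I) (XL6 J₀) = true) {k : ℝ × ℝ} (hk : k ∈ cellIcc 64 (I, J)) :
    (e : ℝ) < abEnergyK (Δ : ℝ) a b c k := by
  obtain ⟨-, -, -, -, -, -, hD, hN, -⟩ := levelZ_spec hl
  rw [XL6_eq hI.le, XL6_eq (by omega : J₀ ≤ 64)] at h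
  have ht := outer_real_of_outerZ hl h
  refine lt_abBand_on_cell (by norm_num) gridEncl64 (by omega) (by omega) hD hN ?_ hk
  rw [xl384_cast, xl384_cast]
  have hm : ((XL (6 * J₀) : ℤ) : ℝ) ≤ ((XL (6 * J) : ℤ) : ℝ) := by exact_mod_cast XL_mono (by omega) (by omega)
  have h0 : (0 : ℝ) ≤ ((XL (6 * I) : ℤ) : ℝ) := by exact_mod_cast (tables_range (i := 6 * I) (by omega)).1
  have h0' : (0 : ℝ) ≤ ((XL (6 * J₀) : ℤ) : ℝ) := by exact_mod_cast (tables_range (i := 6 * J₀) (by omega)).1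
  nlinarith [mul_nonneg hD (sub_nonneg.2 hm), mul_nonneg (mul_nonneg hN h0) (sub_nonneg.2 hm)]

/-- COARSE OCCUPIED CELL (`K = 64`). [folklore] -/
theorem coarse_occ_cell {Δ a b c e : ℚ} (hl : levelOK Δ a b c e = true) (hΔ : 0 ≤ Δ) (hc : 0 ≤ c) {I J₁ J : ℕ} (hI : I < 64)
    (hJ : J + 1 ≤ J₁) (hJ₁ : J₁ ≤ 64) (h : innerZ (levelZ Δ a b c e) (XH6 (I + 1)) (XH6 J₁) = true) {k : ℝ × ℝ}
    (hk : k ∈ cellIcc 64 (I, J)) : abEnergyK (Δ : ℝ) a b c k < (e : ℝ) := by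
  obtain ⟨-, -, -, -, -, -, hD, hN, he⟩ := levelZ_spec hl
  rw [XH6_eq (by omega : I + 1 ≤ 64), XH6_eq hJ₁, show 6 * (I + 1) = 6 * I + 6 from by ring] at h
  obtain ⟨h1, h2⟩ := inner_real_of_innerZ hl h
  refine abBand_lt_on_cell (by norm_num) gridEncl64 (by omega) (by omega) (by exact_mod_cast hΔ) (by exact_mod_cast hc) he hD hN
    ?_ ?_ hk
  · rw [show 6 * (I + 1) = 6 * I + 6 from by ring, xh384_cast, xh384_cast]
    have hm : ((XH (6 * (J + 1)) : ℤ) : ℝ) ≤ ((XH (6 * J₁) : ℤ) : ℝ) := by exact_mod_cast XH_mono (by omega) (by omega)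
    have h0 : (0 : ℝ) ≤ ((XH (6 * I + 6) : ℤ) : ℝ) := by exact_mod_cast (tables_range (i := 6 * I + 6) (by omega)).2.2.1
    nlinarith [mul_nonneg hD (sub_nonneg.2 hm), mul_nonneg (mul_nonneg hN h0) (sub_nonneg.2 hm)]
  · rw [show 6 * (I + 1) = 6 * I + 6 from by ring, xh384_cast, xh384_cast]
    have hm : ((XH (6 * (J + 1)) : ℤ) : ℝ) ≤ ((XH (6 * J₁) : ℤ) : ℝ) := by exact_mod_cast XH_mono (by omega) (by omega)
    have h0 : (0 : ℝ) ≤ ((XH (6 * I + 6) : ℤ) : ℝ) := by exact_mod_cast (tables_range (i := 6 * I + 6) (by omega)).2.2.1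
    have hb : (0 : ℝ) ≤ (b : ℝ) ^ 2 := sq_nonneg _
    have ha : (0 : ℝ) ≤ (a : ℝ) ^ 2 := sq_nonneg _
    nlinarith [mul_nonneg (mul_nonneg hb h0) (sub_nonneg.2 hm), mul_nonneg ha (sub_nonneg.2 hm)]

end Summit.Ventures.CertifiedManyBodySolver.Downfold.Emery
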